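import Summits.BirchSwinnertonDyer.Rank1Residual.X11b.AnticyclotomicControlCokernel
import Literature.NumberTheory.GaloisRepresentations.FrobeniusGeneration
import Literature.NumberTheory.GaloisRepresentations.DecompositionGroupOfCompletion
import Literature.NumberTheory.EllipticCurves.ZpExtensionUnramifiedProofs
import HarnessLib

/-!
# X11b, route R1 — places that SPLIT COMPLETELY in `K_∞/K`: a Frobenius in `ker κ` puts the whole
# decomposition group in `ker κ`; for ANTICYCLOTOMIC `κ`, "`Frob_v = Frob_ℓ²`" (`ℓ` inert) does

HONEST FRAMING (cell `b2b-bsdres`, run/shared/lean/b2b/bsd-rank1-residual/, verbatim in every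
file): the goal of the cell is to DELETE the COMBINATION-SHAPED residual classes of the
Birch–Swinnerton-Dyer formula for ALL analytic-rank `≤ 1` elliptic curves over `ℚ` — "full BSD
formula for every rank `≤ 1` curve in class `C`" assembled STRICTLY from published theorems — so
that the rank-`≤ 1` remainder becomes exactly the CONSTRUCTION-SHAPED classes, which are TYPED
(missing-input `Prop`s), NOT attempted. This is not "finishing BSD". Sub-cell
`b2b-bsdres-multr1-p1` (X11b, route R1 = Castella 2018 Thm. A re-proved along the author's
erratum); a RESEARCH ROUTE; no claim beyond the stated class; X11b stays CONSTRUCTION-SHAPED;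
nothing here changes a label; no named fact is minted (proved theorems only; no `sorry`).

## Why this file

`AnticyclotomicControlCokernel` / `AnticyclotomicInfinitePlaces` (this gen) reduced the control
isomorphism `Sel_𝔭^Σ(K, E[p^∞]) ≅ Sel_𝔭^Σ(K_∞, E[p^∞])^Γ` on route R1 to ONE descent hypothesis `hS`
at the finite places `v ∉ Σ`, `v ∤ p`, and discharged it at the places with `D_v ≤ ker κ`
(`resOfLe_mem_awayKer_iff_of_decomp_le`) — the places that SPLIT COMPLETELY in `K_∞/K`. In the
anticyclotomic tower of an imaginary quadratic `K` these are (among the `v ∤ p`) exactly the primes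
lying over rational primes INERT in `K` (`Gal(K_∞/ℚ)` is dihedral: conjugation by a lift of the
nontrivial automorphism of `K` inverts `Γ`, and `Frob_v = Frob_ℓ²` is such a conjugate of itself).
This file proves, on the tree's objects:

* `decompositionSubgroup_le_kerSubgroup_of_frob` — for ANY `ℤ_p`-extension `κ`, a finite place
  `v ∤ p`, a prime `𝔓 ∣ v` of `\bar ℤ_K` and an arithmetic Frobenius `φ` at `𝔓`: **if `κ φ = 1` then
  `D_𝔓 ≤ ker κ`** — `κ` is unramified at `v` (tree `ZpExtension.inertia_le_kerSubgroup_holds`,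
  Washington Prop. 13.2) and `D_𝔓` is generated by `I_𝔓` and `φ` modulo every open subgroup (tree
  `exists_eq_frobenius_pow_mul_of_mem_decompositionSubgroup`, applied to the layers `κ⁻¹(p^mℤ_p)`;
  `⋂_m κ⁻¹(p^mℤ_p) = ker κ`);
* `decomp_le_kerSubgroup_of_frob` — the same for `decomp v = D_{𝔓₀}`, `𝔓₀` the prime of the chosen
  embedding (tree `decompositionSubgroup_adicCompletionPrime_eq_range`);
* `IsAnticyclotomic.apply_eq_one_of_restrict_eq_sq` — for ANTICYCLOTOMIC `κ`: if the restriction of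
  `F ∈ Γ_K` to `Γ_ℚ` is `ρ²` with `ρ ∉ res(Γ_K)` (i.e. `ρ|_K ≠ 1`), then `κ F = 1` (the defining
  relation with `σ = τ = F`: `κ F = (κ F)⁻¹` in the torsion-free `ℤ_p`);
* **`IsAnticyclotomic.decomp_le_kerSubgroup_of_frob_eq_sq`** and the away-descent corollary
  **`IsAnticyclotomic.resOfLe_mem_awayKer_iff_of_frob_eq_sq`**: for anticyclotomic `κ` and a place
  `v ∤ p` admitting an arithmetic Frobenius `φ` at `𝔓₀` with `res φ = ρ²`, `ρ ∉ res(Γ_K)` ("`v` lies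
  over a prime inert in `K`", in Frobenius form), `D_v ≤ ker κ` and Castella's away condition at `v`
  descends from `K_∞` to `K`.

What is NOT here: the construction of such `φ, ρ` from "`ℓ` inert in `K`" (`Frob_v = Frob_ℓ²` along
the identification `ℚ̄ = K̄`) — the hypothesis is kept in Frobenius form; the split primes `ℓ` (where
`D_v/D_v ∩ ker κ ≅ ℤ_p` and Greenberg's Lemma 3.3 is needed).

References: [Washington1997] Prop. 13.2 (`ℤ_p`-extensions unramified outside `p`); [NeukirchANT1999]
I §9 (9.4) (decomposition group generated by inertia and Frobenius); [GreenbergLNM1716] §3 p. 87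
(primes splitting completely); [Brink–Washington / folklore] inert primes split completely in the
anticyclotomic `ℤ_p`-extension (dihedral `Gal(K_∞/ℚ)`).
-/

noncomputable section

open scoped Classical

open NumberField IsDedekindDomain Field
open Literature.NumberTheory.EllipticCurves Literature.NumberTheory.EllipticCurves.GreenbergSelmer
open Literature.NumberTheory.GaloisRepresentations

universe u

namespace Summit.BirchSwinnertonDyer.Rank1Residual.X11b.AcSelmer

variable {K : Type u} [Field K] [NumberField K] {p : ℕ} [Fact p.Prime] (κ : ZpExtension K p)

/-! ## A Frobenius in `ker κ` puts the decomposition group in `ker κ` -/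

section Frobenius

/-- **`κ φ = 1` for an arithmetic Frobenius `φ` at `𝔓 ∣ v`, `v ∤ p` ⟹ `D_𝔓 ≤ ker κ`** (the place `v`
splits completely in `K_∞/K`), for ANY `ℤ_p`-extension `κ`: modulo each open layer subgroup
`κ⁻¹(p^mℤ_p)` every `d ∈ D_𝔓` is `φⁿ · i · u` with `i ∈ I_𝔓 ≤ ker κ` (unramified outside `p`), so
`κ d ∈ p^m ℤ_p` for every `m`, i.e. `κ d = 1`.
[cite: Washington1997, Prop. 13.2] [cite: NeukirchANT1999, I §9 Prop. (9.4)] -/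
theorem decompositionSubgroup_le_kerSubgroup_of_frob {v : HeightOneSpectrum (𝓞 K)}
    (hpv : ((p : ℕ) : 𝓞 K) ∉ v.asIdeal) {𝔓 : Ideal (absIntegers (𝓞 K) K)} (h𝔓 : 𝔓 ∈ v.primesAbove)
    {φ : absoluteGaloisGroup K} (hφ : IsArithFrobAt (𝓞 K) φ 𝔓) (hκφ : κ φ = 1) :
    𝔓.decompositionSubgroup (absoluteGaloisGroup K) ≤ κ.kerSubgroup := by
  intro d hd
  refine mem_kerSubgroup_of_forall_mem_layerSubgroup κ fun m ↦ ?_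
  obtain ⟨n, i, u, hi, hu, rfl⟩ := exists_eq_frobenius_pow_mul_of_mem_decompositionSubgroup h𝔓 hφ
    (κ.isOpen_layerSubgroup m) hd
  have hiker : κ i = 1 :=
    ZpExtension.mem_kerSubgroup.mp (ZpExtension.inertia_le_kerSubgroup_holds K p κ hpv h𝔓 hi)
  have e : κ (φ ^ n * i * u) = κ u := by
    rw [map_mul, map_mul, map_pow, hκφ, hiker, one_pow, one_mul, one_mul]
  rw [ZpExtension.mem_layerSubgroup, e]
  exact ZpExtension.mem_layerSubgroup.mp hu

/-- **The same for `decomp v = D_{𝔓₀}`**, `𝔓₀ = adicCompletionPrime K v` the prime of `\bar ℤ_K`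
above `v` cut out by the chosen embedding `K̄ → \bar K_v` (tree
`decompositionSubgroup_adicCompletionPrime_eq_range`): an arithmetic Frobenius `φ` at `𝔓₀` with
`κ φ = 1` gives `decomp v ≤ ker κ`. [cite: NeukirchANT1999, Ch. II §9 Prop. (9.6) and I §9 (9.4)] [cite: Washington1997, Prop. 13.2] -/
theorem decomp_le_kerSubgroup_of_frob {v : HeightOneSpectrum (𝓞 K)}
    (hpv : ((p : ℕ) : 𝓞 K) ∉ v.asIdeal) {φ : absoluteGaloisGroup K}
    (hφ : IsArithFrobAt (𝓞 K) φ (adicCompletionPrime K v)) (hκφ : κ φ = 1) :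
    decomp v ≤ κ.kerSubgroup := by
  have e : decomp v = (adicCompletionPrime K v).decompositionSubgroup (absoluteGaloisGroup K) := by
    rw [decompositionSubgroup_adicCompletionPrime_eq_range]; rfl
  rw [e]
  exact decompositionSubgroup_le_kerSubgroup_of_frob κ hpv (adicCompletionPrime_mem_primesAbove K v)
    hφ hκφ

end Frobenius

/-! ## Anticyclotomic `κ`: a Frobenius that is a square from outside `Γ_K` lies in `ker κ` -/

section Anticyclotomic

/-- In `ℤ_p` (written multiplicatively), `x = x⁻¹` forces `x = 1` (`2x = 0 ⟹ x = 0`). [folklore] -/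
theorem multiplicative_padicInt_eq_one_of_eq_inv {x : Multiplicative ℤ_[p]} (h : x = x⁻¹) : x = 1 := by
  have h2 : x.toAdd + x.toAdd = 0 := by
    have := congrArg Multiplicative.toAdd h
    rw [toAdd_inv] at this
    exact eq_neg_iff_add_eq_zero.mp this
  exact toAdd_eq_zero.mp (add_self_eq_zero.mp h2)

/-- **Anticyclotomic `κ`: if `res F = ρ²` in `Γ_ℚ` with `ρ ∉ res(Γ_K)`, then `κ F = 1`.** The
defining relation of `ZpExtension.IsAnticyclotomic` with `σ = τ = F` and this `ρ`
(`ρ · res F · ρ⁻¹ = ρ ρ ρ ρ⁻¹ = res F`) gives `κ F = (κ F)⁻¹`. Intended: `F` a Frobenius at a prime of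
`K` over a rational prime `ℓ` INERT in `K`, `ρ` a Frobenius at `ℓ` (`ρ|_K ≠ 1`, `Frob_v = Frob_ℓ²`).
[cite: GreenbergLNM1716, §3 p. 87 (primes splitting completely)] [cite: Washington1997, §13.1] -/
theorem IsAnticyclotomic.apply_eq_one_of_restrict_eq_sq {κ : ZpExtension K p}
    (hκ : κ.IsAnticyclotomic) {F : absoluteGaloisGroup K} {ρ : absoluteGaloisGroup ℚ}
    (hρ : ρ ∉ Set.range (absGaloisRestrict ℚ K)) (hF : absGaloisRestrict ℚ K F = ρ * ρ) :
    κ F = 1 := by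
  have h := hκ F F ρ hρ (by rw [hF]; group)
  exact multiplicative_padicInt_eq_one_of_eq_inv h

/-- **Anticyclotomic `κ`, `v ∤ p` with "`Frob_v = Frob_ℓ²`, `ℓ` inert" in Frobenius form ⟹
`D_v ≤ ker κ`**: `v` splits completely in `K_∞/K`. [cite: GreenbergLNM1716, §3 p. 87] [cite: Washington1997, Prop. 13.2] -/
theorem IsAnticyclotomic.decomp_le_kerSubgroup_of_frob_eq_sq {κ : ZpExtension K p}
    (hκ : κ.IsAnticyclotomic) {v : HeightOneSpectrum (𝓞 K)} (hpv : ((p : ℕ) : 𝓞 K) ∉ v.asIdeal)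
    {φ : absoluteGaloisGroup K} (hφ : IsArithFrobAt (𝓞 K) φ (adicCompletionPrime K v))
    {ρ : absoluteGaloisGroup ℚ} (hρ : ρ ∉ Set.range (absGaloisRestrict ℚ K))
    (hF : absGaloisRestrict ℚ K φ = ρ * ρ) : decomp v ≤ κ.kerSubgroup :=
  decomp_le_kerSubgroup_of_frob κ hpv hφ (IsAnticyclotomic.apply_eq_one_of_restrict_eq_sq hκ hρ hF)

variable {M : Type u} [AddCommGroup M] [DistribMulAction (absoluteGaloisGroup K) M]
  [TopologicalSpace M] [DiscreteTopology M]

/-- **… hence Castella's AWAY condition at such a `v` DESCENDS from `K_∞` to `K`** (the hypothesis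
`hS` of `controlMap_bijective_of_away_descent` at the places over inert primes): for
`c ∈ H¹(⊤, M) = H¹(K, M)`, `res_{K→K_∞} c` is locally trivial at the chosen place above `v` iff `c` is
locally trivial at `v` (`resOfLe_mem_awayKer_iff_of_decomp_le`). [cite: GreenbergLNM1716, §3 p. 87 (primes splitting completely)] -/
theorem IsAnticyclotomic.resOfLe_mem_awayKer_iff_of_frob_eq_sq {κ : ZpExtension K p}
    (hκ : κ.IsAnticyclotomic) {v : HeightOneSpectrum (𝓞 K)} (hpv : ((p : ℕ) : 𝓞 K) ∉ v.asIdeal)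
    {φ : absoluteGaloisGroup K} (hφ : IsArithFrobAt (𝓞 K) φ (adicCompletionPrime K v))
    {ρ : absoluteGaloisGroup ℚ} (hρ : ρ ∉ Set.range (absGaloisRestrict ℚ K))
    (hF : absGaloisRestrict ℚ K φ = ρ * ρ)
    (c : subgroupH1 (⊤ : Subgroup (absoluteGaloisGroup K)) M) :
    resOfLe M (le_top : κ.kerSubgroup ≤ ⊤) c ∈ awayKer κ.kerSubgroup M v ↔ c ∈ awayKer ⊤ M v :=
  resOfLe_mem_awayKer_iff_of_decomp_le v
    (IsAnticyclotomic.decomp_le_kerSubgroup_of_frob_eq_sq hκ hpv hφ hρ hF) c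

/-- Generic form (any `κ`): a Frobenius at `𝔓₀ ∣ v` in `ker κ`, `v ∤ p` ⟹ the away condition at `v`
descends. [cite: GreenbergLNM1716, §3 p. 87 (primes splitting completely)] -/
theorem resOfLe_mem_awayKer_iff_of_frob {v : HeightOneSpectrum (𝓞 K)}
    (hpv : ((p : ℕ) : 𝓞 K) ∉ v.asIdeal) {φ : absoluteGaloisGroup K}
    (hφ : IsArithFrobAt (𝓞 K) φ (adicCompletionPrime K v)) (hκφ : κ φ = 1)
    (c : subgroupH1 (⊤ : Subgroup (absoluteGaloisGroup K)) M) :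
    resOfLe M (le_top : κ.kerSubgroup ≤ ⊤) c ∈ awayKer κ.kerSubgroup M v ↔ c ∈ awayKer ⊤ M v :=
  resOfLe_mem_awayKer_iff_of_decomp_le v (decomp_le_kerSubgroup_of_frob κ hpv hφ hκφ) c

end Anticyclotomic

end Summit.BirchSwinnertonDyer.Rank1Residual.X11b.AcSelmer

end
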